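import Summits.AtomisticToContinuum.Crystallization.Theses.IsometryAtoms
import Summits.AtomisticToContinuum.Crystallization.Theorems.PalmUnimodularRigidityMinimiserShellsEnergyFloor
import Summits.AtomisticToContinuum.Crystallization.Theorems.IsometryAtomsMinimisingLawsCohesiveMeasurableClassB
import Summits.AtomisticToContinuum.Crystallization.Theorems.IsometryAtomsMinimisingLawsCohesiveGroupStructure
import Summits.AtomisticToContinuum.Crystallization.Theorems.IsometryAtomsMinimisingLawsCohesivePureExhaustion
import Summits.AtomisticToContinuum.Crystallization.Theorems.IsometryAtomsMinimisingLawsCohesiveFiniteOrbitsOfCharged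
import Summits.AtomisticToContinuum.Crystallization.Theorems.IsometryAtomsMinimisingLawsCohesiveSlabOrDense
import Summits.AtomisticToContinuum.Crystallization.Theorems.IsometryAtomsMinimisingLawsCohesiveNoSlabs

/-!
# `IsometryAtoms.MinimisingLawsCohesive` from `IsometryAtoms.MinimisingLawsHaveAtoms`
# (crux stmt-AtomisticToContinuum-15777, line `purity_stacking`)

**Theorem.** PURITY implies COHESION: if every minimising point-stationary hard-core Lennard-Jones
law charges a rooted isometry class (`MinimisingLawsHaveAtoms`, the sibling crux X₁ of route
`IsometryAtoms`, stmt-15776), then every such law is almost surely relatively dense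
(`MinimisingLawsCohesive`, this crux X₂).

**Proof** (composition of the seven landed stubs of line `purity_stacking`; the energy floor S1 is
the tree theorem `UnimodularEnergyLowerBound`, item 9229): a.e. configuration `μ` lies in a CHARGED
rooted-isometry class `Cls Y` (pure exhaustion `stub_pureExhaustion`, fed with X₁, the floor and the
Giry measurability of classes `measurableClass_b`) and is hard-core; a.e. `μ` is not a slab
(`stub_noSlabs`, stacking against the floor); hence `Y` has finitely many symmetry orbits
(`stub_finiteOrbitsOfCharged`: Mecke mass formula + structure of discontinuous isometry groups of
`ℝ³`, `stub_groupStructure`, and discontinuity of the symmetry group, `symDiscontinuous_b` below), so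
`μ` is relatively dense or a slab (`stub_slabOrDense`), and the slab branch is absurd.

The result is CONDITIONAL on X₁ by design of the route (its `closes` consumes X₁ and X₂ side by
side); for isometry-diffuse minimising laws nothing is claimed.

Import-cone note: the landed `stub_symDiscontinuous` / `stub_measurableClass` files import
`Literature…LocalMatchingCompactness → …MuGroundStateConfiguration`, which redeclares
`Literature.MathematicalPhysics.StatisticalMechanics.UniformlyDiscrete` of `…MuGSC` (the latter is in
the cone of the energy floor), so they cannot be imported here; the discontinuity of the symmetry
group is therefore re-proved below (same proof, finiteness of separated bounded sets via
`UniformlyDiscrete.finite_inter_closedBall`), and measurability comes from `…MeasurableClassB`.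
-/

noncomputable section

namespace Summit.AtomisticToContinuum.Crystallization.Theorems

open MeasureTheory
open Summit.AtomisticToContinuum.Crystallization.Theses.IsometryAtoms (MinimisingLawsCohesive MinimisingLawsHaveAtoms)
open Summit.AtomisticToContinuum.Crystallization.Theorems.IsometryAtomsMinimisingLawsCohesive
  (stub_groupStructure stub_pureExhaustion stub_finiteOrbitsOfCharged stub_slabOrDense stub_noSlabs)

namespace IsometryAtomsMinimisingLawsCohesive.SymDiscontinuousB

/-- A non-coplanar subset of `ℝ³` (no nonzero normal vector `n` with `⟪y, n⟫` constant on `Y`)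
affinely spans the whole space. -/
private theorem affineSpan_eq_top {Y : Set (EuclideanSpace ℝ (Fin 3))}
    (hY : ¬ ∃ n : EuclideanSpace ℝ (Fin 3), n ≠ 0 ∧ ∃ c : ℝ, ∀ y ∈ Y, inner ℝ y n = c) :
    affineSpan ℝ Y = ⊤ := by
  by_contra hne
  apply hY
  rcases Y.eq_empty_or_nonempty with hYe | ⟨p, hp⟩
  · refine ⟨EuclideanSpace.single 0 1, ?_, 0, fun y hy => ?_⟩
    · intro h
      have h1 := congrArg (fun v : EuclideanSpace ℝ (Fin 3) => v 0) h
      simp at h1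
    · rw [hYe] at hy
      exact absurd hy (Set.notMem_empty _)
  · have hdir : (affineSpan ℝ Y).direction ≠ ⊤ := by
      intro htop
      exact hne ((AffineSubspace.direction_eq_top_iff_of_nonempty
        ((affineSpan_nonempty (k := ℝ) (s := Y)).mpr ⟨p, hp⟩)).mp htop)
    have horth : (affineSpan ℝ Y).directionᗮ ≠ ⊥ := by
      rwa [Ne, Submodule.orthogonal_eq_bot_iff]
    obtain ⟨n, hn, hn0⟩ := (Submodule.ne_bot_iff _).mp horth
    refine ⟨n, hn0, inner ℝ p n, fun y hy => ?_⟩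
    have hmem : y -ᵥ p ∈ (affineSpan ℝ Y).direction :=
      AffineSubspace.vsub_mem_direction (mem_affineSpan ℝ hy) (mem_affineSpan ℝ hp)
    have h0 : inner ℝ (y - p) n = 0 := Submodule.inner_right_of_mem_orthogonal hmem hn
    rwa [inner_sub_left, sub_eq_zero] at h0

/-- For an affine isometry `g` and points `p`, `x`: `‖g p‖ ≤ ‖p‖ + ‖x‖ + ‖g x‖`. -/
private theorem norm_map_le (g : EuclideanSpace ℝ (Fin 3) ≃ᵃⁱ[ℝ] EuclideanSpace ℝ (Fin 3))
    (p x : EuclideanSpace ℝ (Fin 3)) : ‖g p‖ ≤ ‖p‖ + ‖x‖ + ‖g x‖ := by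
  calc ‖g p‖ = ‖(g p - g x) + g x‖ := by rw [sub_add_cancel]
    _ ≤ ‖g p - g x‖ + ‖g x‖ := norm_add_le _ _
    _ = dist p x + ‖g x‖ := by rw [← dist_eq_norm, g.dist_map]
    _ ≤ ‖p‖ + ‖x‖ + ‖g x‖ := by
      gcongr
      exact dist_le_norm_add_norm _ _

/-- **Discontinuity of the symmetry group of a separated non-coplanar point set** (the statement of
the landed `stub_symDiscontinuous`, binders `Y`, `R` first): if `Y ⊆ ℝ³` is `δ`-separated
(`δ > 0`) and non-coplanar, then for every `R` only finitely many Euclidean isometries `g` with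
`g '' Y = Y` move some point of the closed ball `‖x‖ ≤ R` into that ball. -/
theorem symDiscontinuous_b (Y : Set (EuclideanSpace ℝ (Fin 3))) (R δ : ℝ) (hδ : 0 < δ)
    (hsep : ∀ x ∈ Y, ∀ y ∈ Y, x ≠ y → δ ≤ dist x y)
    (hY : ¬ ∃ n : EuclideanSpace ℝ (Fin 3), n ≠ 0 ∧ ∃ c : ℝ, ∀ y ∈ Y, inner ℝ y n = c) :
    {g : EuclideanSpace ℝ (Fin 3) ≃ᵃⁱ[ℝ] EuclideanSpace ℝ (Fin 3) |
        g '' Y = Y ∧ ∃ x : EuclideanSpace ℝ (Fin 3), ‖x‖ ≤ R ∧ ‖g x‖ ≤ R}.Finite := by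
  classical
  obtain ⟨t, htY, htspan, htind⟩ := exists_affineIndependent ℝ (EuclideanSpace ℝ (Fin 3)) Y
  rw [affineSpan_eq_top hY] at htspan
  have htfin : t.Finite := finite_set_of_fin_dim_affineIndependent ℝ htind
  haveI : Finite t := htfin.to_subtype
  -- evaluation of an isometry on the affine frame `t`
  let Φ : (EuclideanSpace ℝ (Fin 3) ≃ᵃⁱ[ℝ] EuclideanSpace ℝ (Fin 3)) →
      (t → EuclideanSpace ℝ (Fin 3)) := fun g p => g p
  have hinj : Set.InjOn Φ {g : EuclideanSpace ℝ (Fin 3) ≃ᵃⁱ[ℝ] EuclideanSpace ℝ (Fin 3) |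
      g '' Y = Y ∧ ∃ x : EuclideanSpace ℝ (Fin 3), ‖x‖ ≤ R ∧ ‖g x‖ ≤ R} := by
    intro g₁ _ g₂ _ h
    apply AffineIsometryEquiv.toAffineEquiv_injective
    refine AffineEquiv.ext_on htspan _ _ (fun p hp => ?_)
    have h1 := congr_fun h ⟨p, hp⟩
    simpa [Φ] using h1
  have himg : Φ '' {g : EuclideanSpace ℝ (Fin 3) ≃ᵃⁱ[ℝ] EuclideanSpace ℝ (Fin 3) |
      g '' Y = Y ∧ ∃ x : EuclideanSpace ℝ (Fin 3), ‖x‖ ≤ R ∧ ‖g x‖ ≤ R} ⊆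
      {f : t → EuclideanSpace ℝ (Fin 3) | ∀ p : t, f p ∈
        Y ∩ Metric.closedBall 0 (‖(p : EuclideanSpace ℝ (Fin 3))‖ + R + R)} := by
    rintro _ ⟨g, ⟨hgY, x, hx, hgx⟩, rfl⟩ p
    refine ⟨?_, ?_⟩
    · rw [← hgY]
      exact Set.mem_image_of_mem _ (htY p.2)
    · rw [mem_closedBall_zero_iff]
      calc ‖g p‖ ≤ ‖(p : EuclideanSpace ℝ (Fin 3))‖ + ‖x‖ + ‖g x‖ := norm_map_le g p x
        _ ≤ ‖(p : EuclideanSpace ℝ (Fin 3))‖ + R + R := by gcongr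
  have hfin : {f : t → EuclideanSpace ℝ (Fin 3) | ∀ p : t, f p ∈
      Y ∩ Metric.closedBall 0 (‖(p : EuclideanSpace ℝ (Fin 3))‖ + R + R)}.Finite :=
    Set.Finite.pi' fun p =>
      Literature.MathematicalPhysics.StatisticalMechanics.UniformlyDiscrete.finite_inter_closedBall
        (X := Y) ⟨δ, hδ, hsep⟩ 0 _
  exact Set.Finite.of_finite_image (hfin.subset himg) hinj

end IsometryAtomsMinimisingLawsCohesive.SymDiscontinuousB

open IsometryAtomsMinimisingLawsCohesive.SymDiscontinuousB (symDiscontinuous_b)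
open IsometryAtomsMinimisingLawsCohesive.MeasurableClassB (measurableClass_b)

/-- **PURITY ⇒ COHESION** (crux `IsometryAtoms.MinimisingLawsCohesive`, stmt-AtomisticToContinuum-15777,
conditional on the sibling crux `MinimisingLawsHaveAtoms`, stmt-15776): if every minimising
point-stationary hard-core Lennard-Jones law on rooted configurations of `ℝ³` has an atom modulo
isometry, then every such law is almost surely relatively dense. Line `purity_stacking`:
exhaustion by charged classes, orbit finiteness of atoms, slab-or-dense dichotomy, no minimising
slabs; the floor `e* ≤ E_P[rootEnergy]` is `PalmUnimodularRigidityMinimiserShells.EnergyFloor.stub_energyFloor`. -/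
theorem minimisingLawsCohesive_of_minimisingLawsHaveAtoms (hX₁ : MinimisingLawsHaveAtoms) :
    MinimisingLawsCohesive := by
  intro δ hδ P hP hhc hst hEn
  -- a.e. configuration lies in a CHARGED rooted-isometry class (purity + floor + measurability) …
  have hex := stub_pureExhaustion hX₁ PalmUnimodularRigidityMinimiserShells.EnergyFloor.stub_energyFloor
    (fun δ hδ Y hY q => measurableClass_b q Y δ hδ hY) δ hδ P hP hhc hst hEn
  -- … and a.e. configuration is not a slab (floor + stacking)
  have hns := stub_noSlabs PalmUnimodularRigidityMinimiserShells.EnergyFloor.stub_energyFloor δ hδ P hP hhc hst hEn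
  filter_upwards [hex, hns, hhc] with μ hμ hnμ hhcμ
  obtain ⟨Y, hY, hμY⟩ := hμ
  -- the charged class has finitely many symmetry orbits (its copy `μ` is no slab), hence dense or slab
  rcases stub_slabOrDense (fun δ hδ Y hY hnc R => symDiscontinuous_b Y R δ hδ hY hnc) stub_groupStructure δ hδ Y
      (stub_finiteOrbitsOfCharged (fun δ hδ Y hY q => measurableClass_b q Y δ hδ hY)
        (fun δ hδ Y hY hnc R => symDiscontinuous_b Y R δ hδ hY hnc) stub_groupStructure δ hδ P hP hhc hst Y hY μ
        hμY hhcμ hnμ) μ hμY hhcμ with h | h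
  · exact h
  · exact absurd h hnμ

end Summit.AtomisticToContinuum.Crystallization.Theorems

end
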